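import Summits.BirchSwinnertonDyer.BirchSwinnertonDyer.Theorems.ThetaPartnerAtTwoSignedControlAtTwoH1SigmaGrowthBound
import Summits.BirchSwinnertonDyer.BirchSwinnertonDyer.Theorems.ThetaPartnerAtTwoSignedControlAtTwoH1SigmaCorankBound
import Literature.NumberTheory.EllipticCurves.IwasawaSelmerSupersingularSplit
import Literature.NumberTheory.EllipticCurves.IwasawaSelmerNonTorsionFromLayersProofs
import Literature.NumberTheory.EllipticCurves.IwasawaSelmerControlKernelProofs
import Literature.NumberTheory.EllipticCurves.BSDConductorProofs
import HarnessLib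

/-!
# The dual of `H¹(K_Σ/K_∞, E[p^∞])` is NOT `Λ`-torsion, from the finite-level Euler-characteristic count (I1)
# `relaxedSelmer_torsion_card_growth` ALONE — and `rank_Λ Y = 1` over `ℚ` with no weak Leopoldt and no Coates–Greenberg

Crux K4 `SignedControlAtTwo` (stmt-BirchSwinnertonDyer-20309; routes `ThetaPartnerAtTwo` / `ResidualThetaTransportAtTwo`), line
`eulerchar` v8 → v9 (lead `prover-bsd-wall-tp2-p3` g3). The v8 residue cites Greenberg's Thm. 1.7 (`X(E/ℚ_∞)` not `Λ`-torsion at a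
supersingular prime = (I1) global count + (I2) Coates–Greenberg `H¹(K_{∞,η}, 𝓕(𝔪̄)) = 0`) to get `rank_Λ Y ≥ 1` for the dual `Y` of
`H = H¹(K_Σ/K_∞, E[p^∞])` via the quotient `Y ↠ X(E/K_∞)`. But (I2) is only needed to make the relaxed classes of (I1) SELMER at the
place above `p`; the classes are unramified outside `S₀ ∪ {v ∣ p}` regardless, hence lie in `H` itself. THIS FILE feeds (I1) directly
into the growth mechanism for `H` (`H1SigmaGrowth.not_isTorsion_of_le_card_fixedBy_torsion`):

* §1 `layerToInfty_mem_unramifiedOutside_of_relaxed` — a class of `H¹(K_n, E[p^∞])` satisfying the classical local condition at every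
  finite `u ≠ v` (`v ∣ p`) restricts into `H¹(K_Σ/K_∞, E[p^∞])` (Kummer condition at a good `u ∤ p` ⇒ unramified, AEC X.4.4; restriction
  preserves `unramifiedOutside`); `exists_finset_unramifiedOutside_of_relaxed` — the transfer of a finite set of such `p^k`-torsion classes
  to `H^{γ^{pⁿ}}[p^k]` with `#F ≤ #ker h_n · #F'`;
* §2 `not_isTorsion_dual_h1Sigma_of_relaxedCount` — (I1) + Lemma 3.1 (`Greenberg1999_ker_layerToInfty_bounded_holds`, cyclotomic `κ`) ⇒
  EVERY finitely generated Pontryagin-dual datum `Y` of `H` is not `Λ`-torsion (any number field `K`, any prime `p`, `γ` a topological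
  generator, `S₀` with good reduction off `S₀ ∪ {u ∣ p}`);
* §3 `h1SigmaInfty_rank_eq_one_of_relaxedCount` — over `ℚ` with `Sel_{p^∞}(E/ℚ)` finite: `rank_Λ Y = 1` from (I1) and the tree THEOREM
  `H1SigmaCorank.h1Sigma_zpCorank_le_degree_holds_rat` (Greenberg pp. 119–120, width seat w3 g4) — i.e. the `hrank` input of the K4 door
  with NEITHER weak Leopoldt (Kato 12.4) NOR Thm. 1.7's Coates–Greenberg half.

THEOREMS ONLY (no definition, no named fact, no `sorry`); the one printed input (I1) is a hypothesis; closes no item; BSD is not proved by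
any of this.

References: [GreenbergLNM1716] §1 (Thm. 1.7 and after, pp. 61–62), §3 Lemma 3.1 (p. 86), §4 pp. 113, 119–120; [SilvermanAEC2009] X.4.4;
[NeukirchSchmidtWingberg2008] (8.7.9) (the source of (I1)).
-/

set_option autoImplicit false
-- the Theorems namespace of this sub repeats the summit name by design (D-0017 nested layout)
set_option linter.dupNamespace false

noncomputable section

open scoped Classical NumberField

open NumberField IsDedekindDomain

universe u

namespace Summit.BirchSwinnertonDyer.BirchSwinnertonDyer.Theorems.SignedEC.H1SigmaGrowth

open Literature.NumberTheory.EllipticCurves Literature.NumberTheory.GaloisRepresentations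
  WeierstrassCurve ZpExtension Literature.NumberTheory.EllipticCurves.IwasawaDual
  Literature.NumberTheory.EllipticCurves.IwasawaAlgebra Literature.NumberTheory.EllipticCurves.GreenbergVatsal2000

/-! ## §1 Relaxed classes of level `n` restrict into `H¹(K_Σ/K_∞, E[p^∞])` -/

section Relaxed

variable {K : Type u} [Field K] [NumberField K] (W : WeierstrassCurve K) [W.IsElliptic] {p : ℕ} [Fact p.Prime]
  (κ : ZpExtension K p)

/-- **A class of `H¹(K_n, E[p^∞])` with the classical local condition at every finite `u ≠ v` (all conjugates), `v ∣ p`, restricts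
into `H¹(K_Σ/K_∞, E[p^∞]) = unramifiedOutside (ker κ) E[p^∞] p S₀`** whenever `W` has good reduction off `S₀ ∪ {u ∣ p}`: at a good
`u ∉ S₀`, `u ∤ p` (so `u ≠ v`) the Kummer condition is unramified (`GreenbergVatsalSelmerLink.localKerOver_le_unramKer`, AEC X.4.4),
and restriction to `K_∞` preserves `unramifiedOutside` (`SSFlatEC.resOfLe_mem_unramifiedOutside`).
[cite: SilvermanAEC2009, Cor. X.4.4] [cite: GreenbergVatsal2000, §2 p. 16] -/
theorem layerToInfty_mem_unramifiedOutside_of_relaxed {S₀ : Set (HeightOneSpectrum (𝓞 K))}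
    (hgood : ∀ u : HeightOneSpectrum (𝓞 K), u ∉ S₀ → ((p : ℕ) : 𝓞 K) ∉ u.asIdeal → W.HasGoodReductionAt u)
    {v : HeightOneSpectrum (𝓞 K)} (hpv : (p : 𝓞 K) ∈ v.asIdeal) (n : ℕ) (y : W.subgroupH1 p (κ.layerSubgroup n))
    (hy : ∀ u : HeightOneSpectrum (𝓞 K), u ≠ v → ∀ σ : Field.absoluteGaloisGroup K,
      W.conjH1 p (κ.layerSubgroup n) σ y ∈ W.localKerOver p (κ.layerSubgroup n) (u.adicCompletion K)) :
    W.layerToInfty κ n y ∈ unramifiedOutside κ.kerSubgroup (W.geomPrimaryTorsion p) p S₀ := by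
  have hyS : y ∈ unramifiedOutside (κ.layerSubgroup n) (W.geomPrimaryTorsion p) p S₀ := by
    rw [mem_unramifiedOutside_iff]
    intro u hu hpu σ
    have huv : u ≠ v := by
      rintro rfl
      exact hpu (by exact_mod_cast hpv)
    exact Summit.BirchSwinnertonDyer.Rank1Residual.X2.GreenbergVatsalSelmerLink.localKerOver_le_unramKer (W := W) (p := p)
      (H := κ.layerSubgroup n) (hgood u hu hpu) hpu (hy u huv σ)
  exact SSFlatEC.resOfLe_mem_unramifiedOutside (W.geomPrimaryTorsion p) (κ.kerSubgroup_le_layerSubgroup n) p S₀ hyS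

/-- **From relaxed `p^k`-torsion classes of level `n` to `H^{γ^{pⁿ}}[p^k]`** (`H = H¹(K_Σ/K_∞, E[p^∞])`): the image under `h_n` of a finite
set `F` of such classes is a finite set of classes of `H` fixed by `conj_{γ^{pⁿ}}` (`γ^{pⁿ} ∈ Gal(K̄/K_n)`) and killed by `p^k`, and
`#F ≤ #ker h_n · #h_n(F)` (fibre counting). VERBATIM the tree's `exists_finset_selmerInfty_of_selmerInftyPreimage` with `Sel_∞` ↦ `H`.
[cite: GreenbergLNM1716, §1 p. 62, §3 Lemma 3.1] -/
theorem exists_finset_unramifiedOutside_of_relaxed {γ : Field.absoluteGaloisGroup K} (hγ : κ.IsTopGenerator γ)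
    {S₀ : Set (HeightOneSpectrum (𝓞 K))}
    (hgood : ∀ u : HeightOneSpectrum (𝓞 K), u ∉ S₀ → ((p : ℕ) : 𝓞 K) ∉ u.asIdeal → W.HasGoodReductionAt u)
    {v : HeightOneSpectrum (𝓞 K)} (hpv : (p : 𝓞 K) ∈ v.asIdeal) (n k : ℕ) [Finite (W.layerToInfty κ n).ker]
    (F : Finset (W.subgroupH1 p (κ.layerSubgroup n)))
    (hF : ∀ y ∈ F, p ^ k • y = 0 ∧ ∀ u : HeightOneSpectrum (𝓞 K), u ≠ v → ∀ σ : Field.absoluteGaloisGroup K,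
      W.conjH1 p (κ.layerSubgroup n) σ y ∈ W.localKerOver p (κ.layerSubgroup n) (u.adicCompletion K)) :
    ∃ F' : Finset (unramifiedOutside κ.kerSubgroup (W.geomPrimaryTorsion p) p S₀),
      (∀ s ∈ F', W.conjH1 p κ.kerSubgroup (γ ^ p ^ n) (s : W.subgroupH1 p κ.kerSubgroup) = s ∧ p ^ k • s = 0) ∧
      F.card ≤ Nat.card (W.layerToInfty κ n).ker * F'.card := by
  set Hs := unramifiedOutside κ.kerSubgroup (W.geomPrimaryTorsion p) p S₀ with hHs
  set A : AddSubgroup (W.subgroupH1 p (κ.layerSubgroup n)) := Hs.comap (W.layerToInfty κ n) with hA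
  have hFA : ∀ y ∈ F, y ∈ A := fun y hy ↦ by
    rw [hA, AddSubgroup.mem_comap]
    exact layerToInfty_mem_unramifiedOutside_of_relaxed W κ hgood hpv n y (hF y hy).2
  -- `h_n` restricted to `A`, with values in `H`
  let g : A →+ Hs := ((W.layerToInfty κ n).comp A.subtype).codRestrict Hs fun y ↦ y.2
  have hg : ∀ y : A, ((g y : Hs) : W.subgroupH1 p κ.kerSubgroup) = W.layerToInfty κ n (y : W.subgroupH1 p (κ.layerSubgroup n)) :=
    fun _ ↦ rfl
  -- `ker g ↪ ker h_n`
  let ι : g.ker → (W.layerToInfty κ n).ker := fun y ↦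
    ⟨((y : A) : W.subgroupH1 p (κ.layerSubgroup n)), (AddMonoidHom.mem_ker).mpr (by
      have hy := congrArg (fun s : Hs ↦ (s : W.subgroupH1 p κ.kerSubgroup)) ((AddMonoidHom.mem_ker).mp y.2)
      simpa only [hg, ZeroMemClass.coe_zero] using hy)⟩
  have hι : Function.Injective ι := fun y₁ y₂ h ↦ by
    have h' : ((y₁ : A) : W.subgroupH1 p (κ.layerSubgroup n)) = ((y₂ : A) : _) :=
      congrArg (fun z : (W.layerToInfty κ n).ker ↦ (z : W.subgroupH1 p (κ.layerSubgroup n))) h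
    exact Subtype.ext (Subtype.ext h')
  haveI : Finite g.ker := Finite.of_injective ι hι
  have hker : Nat.card g.ker ≤ Nat.card (W.layerToInfty κ n).ker := Nat.card_le_card_of_injective ι hι
  let F₀ : Finset A := F.subtype (· ∈ A)
  have hF₀ : F₀.card = F.card := by
    rw [Finset.card_subtype, Finset.filter_true_of_mem fun y hy ↦ hFA y hy]
  refine ⟨F₀.image g, fun s hs ↦ ?_, ?_⟩
  · obtain ⟨y, hy, rfl⟩ := Finset.mem_image.mp hs
    have hyF : ((y : A) : W.subgroupH1 p (κ.layerSubgroup n)) ∈ F := Finset.mem_subtype.mp hy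
    refine ⟨?_, ?_⟩
    · rw [hg]
      exact W.conjH1_layerToInfty_of_mem κ n (κ.pow_mem_layerSubgroup hγ n) _
    · apply Subtype.ext
      rw [AddSubgroupClass.coe_nsmul, hg, ← map_nsmul, (hF _ hyF).1, map_zero, ZeroMemClass.coe_zero]
  · calc F.card = F₀.card := hF₀.symm
      _ ≤ Nat.card g.ker * (F₀.image g).card :=
        Literature.NumberTheory.EllipticCurves.finsetCard_le_natCard_ker_mul_card_image g F₀
      _ ≤ Nat.card (W.layerToInfty κ n).ker * (F₀.image g).card := Nat.mul_le_mul_right _ hker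

end Relaxed

/-! ## §2 (I1) ⇒ the dual of `H¹(K_Σ/K_∞, E[p^∞])` is not `Λ`-torsion -/

section NotTorsion

variable {K : Type u} [Field K] [NumberField K] (W : WeierstrassCurve K) [W.IsElliptic] {p : ℕ} [Fact p.Prime]
  (κ : ZpExtension K p) {γ : Field.absoluteGaloisGroup K}

/-- **(I1) ⇒ `Y` not `Λ`-torsion, for EVERY finitely generated Pontryagin-dual datum `Y` of `H¹(K_Σ/K_∞, E[p^∞])`** (`κ` cyclotomic
with topological generator `γ`; `S₀` with good reduction off `S₀ ∪ {u ∣ p}`; `v ∣ p` any place): the relaxed-at-`v` classes of (I1)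
(`relaxedSelmer_torsion_card_growth`: `≥ p^{k pⁿ}/c(n)` classes of `H¹(K_n, E[p^∞])[p^k]` with the local conditions at all places not
above `v`) restrict into `H^{γ^{pⁿ}}[p^k]` losing at most the bounded factor `#ker h_n ≤ B₀` (Lemma 3.1,
`Greenberg1999_ker_layerToInfty_bounded_holds`), and unbounded growth `p^{k pⁿ}` is incompatible with a torsion dual
(`H1SigmaGrowth.not_isTorsion_of_le_card_fixedBy_torsion`). This is Greenberg's «corank_Λ H¹(F_Σ/F_∞, E[p^∞]) ≥ [F:ℚ]» (LNM 1716
p. 113, from the Euler characteristic over the layers) in the tree's untopologised currency; NO Coates–Greenberg input.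
[cite: GreenbergLNM1716, §4 p. 113 («corank_Λ(H¹(F_Σ/F_∞, E[p^∞])) ≥ [F:ℚ]»), §1 p. 62, §3 Lemma 3.1] [cite: NeukirchSchmidtWingberg2008, (8.7.9)] -/
theorem not_isTorsion_dual_h1Sigma_of_relaxedCount (hκ : κ.IsCyclotomic) (hγ : κ.IsTopGenerator γ)
    {S₀ : Set (HeightOneSpectrum (𝓞 K))}
    (hgood : ∀ u : HeightOneSpectrum (𝓞 K), u ∉ S₀ → ((p : ℕ) : 𝓞 K) ∉ u.asIdeal → W.HasGoodReductionAt u)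
    {v : HeightOneSpectrum (𝓞 K)} (hpv : (p : 𝓞 K) ∈ v.asIdeal)
    (hI1 : WeierstrassCurve.relaxedSelmer_torsion_card_growth.{u})
    {Y : Type*} [AddCommGroup Y] [Module (IwasawaAlgebra p) Y] [Module.Finite (IwasawaAlgebra p) Y]
    (dY : Y →+ (unramifiedOutside κ.kerSubgroup (W.geomPrimaryTorsion p) p S₀ →+ AddCircle (1 : ℚ)))
    (hbij : Function.Bijective dY)
    (hT : ∀ (y : Y) (x : unramifiedOutside κ.kerSubgroup (W.geomPrimaryTorsion p) p S₀),
      dY ((PowerSeries.X : IwasawaAlgebra p) • y) x =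
        dY y ⟨W.conjH1 p κ.kerSubgroup γ x,
          conjH1_mem_unramifiedOutside κ.kerSubgroup (W.geomPrimaryTorsion p) p _ γ x.2⟩ - dY y x)
    (hC : ∀ (a : ℤ_[p]) (y : Y) (x : unramifiedOutside κ.kerSubgroup (W.geomPrimaryTorsion p) p S₀) (k : ℕ),
      (p ^ k) • x = 0 → dY (PowerSeries.C a • y) x = (PadicInt.toZModPow k a).val • dY y x) :
    ¬ Module.IsTorsion (IwasawaAlgebra p) Y := by
  -- the restricted conjugation `φ = conj_γ|` on `H`
  let φ : AddMonoid.End (unramifiedOutside κ.kerSubgroup (W.geomPrimaryTorsion p) p S₀) :=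
    AddMonoidHom.mk' (fun c ↦ ⟨W.conjH1 p κ.kerSubgroup γ c,
        conjH1_mem_unramifiedOutside κ.kerSubgroup (W.geomPrimaryTorsion p) p _ γ c.2⟩)
      (fun a b ↦ Subtype.ext (by
        change W.conjH1 p κ.kerSubgroup γ ((a : W.subgroupH1 p κ.kerSubgroup) + b) =
          W.conjH1 p κ.kerSubgroup γ a + W.conjH1 p κ.kerSubgroup γ b
        exact map_add _ _ _))
  have hφ : ∀ s, ((φ s : unramifiedOutside κ.kerSubgroup (W.geomPrimaryTorsion p) p S₀) : W.subgroupH1 p κ.kerSubgroup) =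
      W.conjH1 p κ.kerSubgroup γ s := fun _ ↦ rfl
  have hT' : ∀ (y : Y) (s : unramifiedOutside κ.kerSubgroup (W.geomPrimaryTorsion p) p S₀),
      dY ((PowerSeries.X : IwasawaAlgebra p) • y) s = dY y (φ s) - dY y s := fun y s ↦ hT y s
  -- Lemma 3.1: `#ker h_n ≤ B₀`
  obtain ⟨B₀, hB₀⟩ := W.Greenberg1999_ker_layerToInfty_bounded_holds κ hκ
  -- (I1): the relaxed count at `v`
  obtain ⟨c, hc⟩ := hI1 K W p κ v hpv
  refine not_isTorsion_of_le_card_fixedBy_torsion W κ hγ _ φ hφ dY hT' hC hbij (fun n ↦ p ^ n) (fun n ↦ c n * B₀)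
    (fun B ↦ ⟨B, Nat.lt_pow_self (Nat.Prime.one_lt Fact.out)⟩) fun n k ↦ ?_
  obtain ⟨F, hF, hle⟩ := hc n k
  obtain ⟨hfin, hcard⟩ := hB₀ n
  haveI := hfin
  obtain ⟨F', hF', hle'⟩ := exists_finset_unramifiedOutside_of_relaxed W κ hγ hgood hpv n k F
    fun y hy ↦ ⟨(hF y hy).1, (hF y hy).2.1⟩
  refine ⟨F', hF', hle.trans ?_⟩
  calc c n * F.card ≤ c n * (Nat.card (W.layerToInfty κ n).ker * F'.card) := Nat.mul_le_mul_left _ hle'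
    _ ≤ c n * (B₀ * F'.card) := Nat.mul_le_mul_left _ (Nat.mul_le_mul_right _ hcard)
    _ = c n * B₀ * F'.card := (mul_assoc _ _ _).symm

end NotTorsion

/-! ## §3 Over `ℚ`: `rank_Λ Y = 1` from (I1) and the PROVED corank count -/

/-- **The K4 door's `hrank` from (I1) ALONE** (over `ℚ`, any prime `p`, `κ` cyclotomic with topological generator `γ`, `Σ₀` finite with
good reduction off `Σ₀ ∪ {p}`, `Sel_{p^∞}(E/ℚ)` finite): every finitely generated Pontryagin-dual datum `Y` of `H¹(ℚ_Σ/ℚ_∞, E[p^∞])` has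
`rank_Λ Y = 1` — `≥ 1` by §2 (not torsion), `≤ 1` by `H1SigmaRank.finrank_le_coinvariantsRank` and the corank count
`corank_{ℤ_p} H¹(ℚ_Σ/ℚ, E[p^∞]) ≤ 1`, now the tree THEOREM `H1SigmaCorank.h1Sigma_zpCorank_le_degree_holds_rat` (Greenberg pp. 119–120).
Neither weak Leopoldt (Kato Thm. 12.4) nor Coates–Greenberg is used.
[cite: GreenbergLNM1716, §4 pp. 113, 119–120; §1 p. 62; §3 Lemma 3.1] [cite: NeukirchSchmidtWingberg2008, (8.7.9)] -/
theorem h1SigmaInfty_rank_eq_one_of_relaxedCount (W : WeierstrassCurve ℚ) [W.IsElliptic] (p : ℕ) [Fact p.Prime]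
    (κ : ZpExtension ℚ p) (γ : Field.absoluteGaloisGroup ℚ) (hκ : κ.IsCyclotomic) (hγ : κ.IsTopGenerator γ)
    (S₀ : Finset (HeightOneSpectrum (𝓞 ℚ)))
    (hgood : ∀ v : HeightOneSpectrum (𝓞 ℚ), v ∉ S₀ → ((p : ℕ) : 𝓞 ℚ) ∉ v.asIdeal → W.HasGoodReductionAt v)
    (hI1 : WeierstrassCurve.relaxedSelmer_torsion_card_growth.{0}) (hSel : Finite (W.selmerGroupPInfty p))
    (Y : Type) [AddCommGroup Y] [Module (IwasawaAlgebra p) Y] [Module.Finite (IwasawaAlgebra p) Y]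
    (dY : Y →+ (unramifiedOutside κ.kerSubgroup (W.geomPrimaryTorsion p) p
      (↑S₀ : Set (HeightOneSpectrum (𝓞 ℚ))) →+ AddCircle (1 : ℚ)))
    (hbij : Function.Bijective dY)
    (hT : ∀ (y : Y) (c : unramifiedOutside κ.kerSubgroup (W.geomPrimaryTorsion p) p
        (↑S₀ : Set (HeightOneSpectrum (𝓞 ℚ)))),
      dY ((PowerSeries.X : IwasawaAlgebra p) • y) c =
        dY y ⟨W.conjH1 p κ.kerSubgroup γ c,
          conjH1_mem_unramifiedOutside κ.kerSubgroup (W.geomPrimaryTorsion p) p _ γ c.2⟩ - dY y c)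
    (hC : ∀ (a : ℤ_[p]) (y : Y) (c : unramifiedOutside κ.kerSubgroup (W.geomPrimaryTorsion p) p
        (↑S₀ : Set (HeightOneSpectrum (𝓞 ℚ)))) (k : ℕ), (p ^ k) • c = 0 →
      dY (PowerSeries.C a • y) c = (PadicInt.toZModPow k a).val • dY y c) :
    Module.rank (IwasawaAlgebra p) Y = 1 := by
  have hp : p.Prime := Fact.out
  have hgood' : ∀ w : HeightOneSpectrum (𝓞 ℚ), w ∉ (↑S₀ : Set (HeightOneSpectrum (𝓞 ℚ))) →
      ((p : ℕ) : 𝓞 ℚ) ∉ w.asIdeal → W.HasGoodReductionAt w :=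
    fun w hw hpw ↦ hgood w (fun h ↦ hw (Finset.mem_coe.mpr h)) hpw
  -- the place of `ℚ` above `p`
  have hpv : (p : 𝓞 ℚ) ∈ ((Rat.HeightOneSpectrum.primesEquiv (R := 𝓞 ℚ)).symm ⟨p, hp⟩).asIdeal :=
    (natCast_mem_asIdeal_iff_eq_primesEquiv_symm _ hp).mpr rfl
  have hnt := not_isTorsion_dual_h1Sigma_of_relaxedCount W κ hκ hγ hgood' hpv hI1 dY hbij hT hC
  refine H1SigmaRank.rank_eq_one_of_not_isTorsion_of_coinvariantsRank_le_one p hnt ?_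
  rw [SSFlatEC.coinvariantsRank_eq_zpCorank_unramifiedOutside_top W κ hγ S₀.finite_toSet dY hbij hT hC]
  have h := H1SigmaCorank.h1Sigma_zpCorank_le_degree_holds_rat W p hSel (↑S₀ : Set (HeightOneSpectrum (𝓞 ℚ))) S₀.finite_toSet hgood'
  rwa [Module.finrank_self] at h

end Summit.BirchSwinnertonDyer.BirchSwinnertonDyer.Theorems.SignedEC.H1SigmaGrowth

end
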